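import Mathlib
import Summits.ValiantsHypothesis.ValiantsHypothesis.Theorems.AlgebraicKWGamesBoundedAlternationLowerBoundCount

/-!
# History-dependent algebraic KW protocols: the generic run

Support machinery for the crux `stmt-ValiantsHypothesis-10298`
(`Summit.ValiantsHypothesis.ValiantsHypothesis.Theses.AlgebraicKWGames.KWPerLowerBound`), filed `--supports`:
the bounded-alternation lower bound of item 10299 (`…Theorems.AlgebraicKWGamesBoundedAlternationLowerBound*`,
oblivious monotone block schedules) is extended to the HISTORY-DEPENDENT speaker schedules of the crux
itself — in round `t` the public zero pattern `z↾t` of the earlier messages decides who speaks,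
`owner t (z↾t)` (`true` = Alice, who holds `a`/`x`; `false` = Bob, who holds `b`/`y`), exactly as in
`KWPerLowerBound` — under the hypothesis that along every zero pattern the speaker alternates at most
`Δ` times.  At the same time the searched polynomial is generalised from `per_n` to an arbitrary
`f ∈ ℂ[x_e : e ∈ Fin n × Fin n]` that depends on every cell (pointwise: for every cell some point and
some new value of that entry change `f`): the adversary below never looks at `f` beyond this.

This file: the structure `HProtocol n T f` (data `owner, msg, out` + dependence of `f` on every cell +
correctness for the KW game of `f`: on inputs with `f a ≠ f b` the output cell `e` has `a_e ≠ b_e`),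
the generic run `gen` on the subspace `{y_e = x_e : e ∈ E}` (strong recursion; the speaker of round `t`
is read off the generic zero pattern), its soundness `generic_output_ne`, the Zariski step
`zariski_step` and the specialisation lemma `gen_eq_subst_gen_of_not_killed` with its consequences for
the generic zero patterns and speakers (`genPat_eq_of_not_killed`, `gOwner_eq_of_not_killed`).
Everything is the schedule-free core of `…BoundedAlternationLowerBoundRun` with `Even (blk t)` replaced
by the pattern-dependent `owner`.

Honest framing: bookkeeping for a lower bound in a toy communication model (boundedly many
alternations); the crux `KWPerLowerBound` (unbounded alternation) is NOT proved here, and nothing in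
this file bears on VP versus VNP.
-/

open MvPolynomial

-- the summit and the problem share the name `ValiantsHypothesis` (D-0017 single-conjunct layout)
set_option linter.dupNamespace false

namespace Summit.ValiantsHypothesis.ValiantsHypothesis.Theorems.AlgebraicKWGames.OneAlt

open scoped Classical

noncomputable section

variable {n : ℕ}

/-! ## `f(x)` and `f(y)` -/

/-- `f(x)`: the polynomial `f` in Alice's variables. -/
def polyX (f : MvPolynomial (Cell n) ℂ) : R n := rename Sum.inl f

/-- `f(y)`: the polynomial `f` in Bob's variables. -/
def polyY (f : MvPolynomial (Cell n) ℂ) : R n := rename Sum.inr f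

/-- Evaluating `f(x)`. -/
theorem eval_polyX (f : MvPolynomial (Cell n) ℂ) (p : Var n → ℂ) :
    eval p (polyX f) = eval (fun c => p (Sum.inl c)) f := by
  rw [polyX, eval_rename]; rfl

/-- Evaluating `f(y)`. -/
theorem eval_polyY (f : MvPolynomial (Cell n) ℂ) (p : Var n → ℂ) :
    eval p (polyY f) = eval (fun c => p (Sum.inr c)) f := by
  rw [polyY, eval_rename]; rfl

/-- **`f(x) - f(y)` survives proper identifications** when `f` depends on every cell (pointwise):
if `E` misses a cell then `subst E (f(x) - f(y)) ≠ 0`. -/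
theorem subst_polyX_sub_polyY_ne_zero {f : MvPolynomial (Cell n) ℂ}
    (hdep : ∀ e₀ : Cell n, ∃ a : Cell n → ℂ, ∃ w : ℂ, eval a f ≠ eval (Function.update a e₀ w) f)
    (E : Finset (Cell n)) {e₀ : Cell n} (he₀ : e₀ ∉ E) :
    subst E (polyX f - polyY f : R n) ≠ 0 := by
  intro h
  obtain ⟨a, w, hne⟩ := hdep e₀
  let p₀ : Var n → ℂ := Sum.elim a (Function.update a e₀ w)
  have hagree : ∀ c ∈ E, p₀ (Sum.inr c) = p₀ (Sum.inl c) := by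
    intro c hc
    have hc' : c ≠ e₀ := fun h => he₀ (h ▸ hc)
    show Function.update a e₀ w c = a c
    exact Function.update_of_ne hc' w a
  have h' := congrArg (eval p₀) h
  rw [eval_subst_of_agree E p₀ hagree, map_sub, map_zero, eval_polyX, eval_polyY, sub_eq_zero] at h'
  exact hne h'

/-! ## History-dependent protocols -/

/-- A zero-test algebraic protocol of depth `T` for the KW game of a polynomial `f` in the `n × n`
cells with a HISTORY-DEPENDENT speaker schedule: `owner t z` is the speaker of round `t` given the zero
pattern `z` of the earlier messages (`true` = Alice, holding `a`; `false` = Bob, holding `b`), as in the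
crux `KWPerLowerBound`; bundled with the pointwise dependence of `f` on every cell and with the
protocol's correctness (on inputs with `f a ≠ f b` the output cell separates `a` from `b`). -/
structure HProtocol (n T : ℕ) (f : MvPolynomial (Cell n) ℂ) : Type where
  /-- the speaker of round `t`, given the zero pattern of the earlier messages (`true` = Alice) -/
  owner : (t : ℕ) → (Fin t → Bool) → Bool
  /-- the message polynomial of round `t`, given the zero pattern of the earlier messages -/
  msg : (t : ℕ) → (Fin t → Bool) → MvPolynomial (Cell n ⊕ Fin t) ℂ
  /-- the output cell, given the zero pattern of the `T` messages -/
  out : (Fin T → Bool) → Cell n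
  /-- `f` depends on every cell: changing one entry of some point changes `f` -/
  dep : ∀ e₀ : Cell n, ∃ a : Cell n → ℂ, ∃ w : ℂ,
    MvPolynomial.eval a f ≠ MvPolynomial.eval (Function.update a e₀ w) f
  /-- correctness for the KW game of `f` -/
  correct : ∀ a b : Cell n → ℂ, MvPolynomial.eval a f ≠ MvPolynomial.eval b f →
    ∀ (m : ℕ → ℂ) (z : ℕ → Bool), (∀ j, z j = true ↔ m j = 0) →
      (∀ t < T, m t = MvPolynomial.eval
        (Sum.elim (if owner t (fun j : Fin t => z j) then a else b) (fun j : Fin t => m j))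
        (msg t (fun j : Fin t => z j))) →
      a (out (fun j : Fin T => z j)) ≠ b (out (fun j : Fin T => z j))

/-- The variables of a speaker: Alice (`true`) holds `x`, Bob (`false`) holds `y`. -/
def svars (o : Bool) (c : Cell n) : R n := if o then X (Sum.inl c) else X (Sum.inr c)

variable {T : ℕ} {f : MvPolynomial (Cell n) ℂ} (P : HProtocol n T f)

namespace HProtocol

/-- One step of the generic run on the subspace `E`: the zero pattern of the earlier generic messages
`q` chooses the speaker and the message polynomial of round `t`; substitute the speaker's variables
and `q`, then identify `y_e` with `x_e` for `e ∈ E`. -/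
def step (E : Finset (Cell n)) (t : ℕ) (q : Fin t → R n) : R n :=
  subst E (aeval (Sum.elim (svars (P.owner t (fun j => decide (q j = 0)))) q)
    (P.msg t (fun j => decide (q j = 0))))

/-- The generic message polynomial of round `t` on the subspace `E` (strong recursion on `t`). -/
def gen (E : Finset (Cell n)) : ℕ → R n :=
  Nat.strongRec (fun t ih => P.step E t (fun j : Fin t => ih j j.2))

/-- The generic zero pattern of round `j` on `E`. -/
def genPat (E : Finset (Cell n)) (j : ℕ) : Bool := decide (P.gen E j = 0)

/-- The generic speaker of round `t` on `E`: the owner of round `t` given the generic zero pattern. -/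
def gOwner (E : Finset (Cell n)) (t : ℕ) : Bool := P.owner t (fun j : Fin t => P.genPat E j)

/-- Unfolding the strong recursion defining `gen`: the generic message of round `t` is the message
polynomial chosen by the generic zero pattern, taken in the generic speaker's variables and the
earlier generic messages, then identified on `E`. -/
theorem gen_eq (E : Finset (Cell n)) (t : ℕ) :
    P.gen E t = subst E (aeval (Sum.elim (svars (P.gOwner E t)) (fun j : Fin t => P.gen E j))
      (P.msg t (fun j : Fin t => P.genPat E j))) := by
  rw [gen, Nat.strongRec_eq]
  rfl

/-- Generic messages on `E` are fixed by every identification inside `E`. -/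
theorem subst_gen_of_subset {E F : Finset (Cell n)} (hFE : F ⊆ E) (t : ℕ) :
    subst F (P.gen E t) = P.gen E t := by
  rw [gen_eq, subst_subst, Finset.union_eq_left.mpr hFE]

/-- `subst F` of a generic message on `E ⊆ F`, as a substitution instance of the same message
polynomial (with the generic speaker of `E`). -/
theorem subst_gen_eq_aeval {E F : Finset (Cell n)} (hEF : E ⊆ F) (t : ℕ) :
    subst F (P.gen E t) = aeval (Sum.elim (fun c => subst F (svars (P.gOwner E t) c)) (fun j : Fin t =>
      subst F (P.gen E j))) (P.msg t (fun j : Fin t => P.genPat E j)) := by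
  rw [gen_eq, subst_subst_of_subset hEF, ← AlgHom.comp_apply, comp_aeval]
  have h : (fun i => subst F (Sum.elim (svars (P.gOwner E t)) (fun j : Fin t => P.gen E j) i)) =
      Sum.elim (fun c => subst F (svars (P.gOwner E t) c)) (fun j : Fin t => subst F (P.gen E j)) := by
    funext i
    rcases i with c | j <;> rfl
  exact congrArg (fun g => aeval g _) h

/-- The generic output cell on the subspace `E`. -/
def genOut (E : Finset (Cell n)) : Cell n := P.out (fun j : Fin T => P.genPat E j)

/-- **Soundness of the generic run.**  At every point `p` that agrees on `E`, at which every nonzero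
generic message of a round `< T` does not vanish, and whose two halves are separated by `f`, the two
halves differ at the generic output cell. -/
theorem generic_output_ne (E : Finset (Cell n)) (p : Var n → ℂ)
    (hpE : ∀ c ∈ E, p (Sum.inr c) = p (Sum.inl c))
    (hgen : ∀ t < T, P.gen E t ≠ 0 → eval p (P.gen E t) ≠ 0)
    (hf : MvPolynomial.eval (fun c => p (Sum.inl c)) f ≠ MvPolynomial.eval (fun c => p (Sum.inr c)) f) :
    p (Sum.inl (P.genOut E)) ≠ p (Sum.inr (P.genOut E)) := by
  set m : ℕ → ℂ := fun t => eval p (P.gen E t) with hm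
  set z : ℕ → Bool := fun j => decide (m j = 0) with hz
  have hpat : ∀ j < T, P.genPat E j = z j := by
    intro j hj
    simp only [genPat, hz, hm]
    by_cases h0 : P.gen E j = 0
    · simp [h0]
    · have := hgen j hj h0
      simp [h0, this]
  have hzT : (fun j : Fin T => P.genPat E j) = fun j : Fin T => z j := by
    funext j; exact hpat j j.2
  have key := P.correct (fun c => p (Sum.inl c)) (fun c => p (Sum.inr c)) hf m z
    (fun j => by simp [hz]) ?_
  · simpa [genOut, hzT] using key
  intro t ht
  have hzt : (fun j : Fin t => z j) = fun j : Fin t => P.genPat E j := by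
    funext j; exact (hpat j (lt_trans j.2 ht)).symm
  rw [hzt]
  show eval p (P.gen E t) = _
  rw [gen_eq, eval_subst_of_agree E p hpE, eval_aeval_eq]
  have hfun : (fun i => eval p (Sum.elim (svars (P.gOwner E t)) (fun j : Fin t => P.gen E j) i)) =
      Sum.elim (if P.owner t (fun j : Fin t => P.genPat E j) then (fun c => p (Sum.inl c))
        else fun c => p (Sum.inr c)) (fun j : Fin t => m j) := by
    funext i
    rcases i with c | j
    · simp only [Sum.elim_inl, svars, gOwner]
      split_ifs <;> simp
    · simp [hm]
  rw [hfun]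

/-! ## The Zariski step -/

/-- The genericity polynomial of the subspace `E`: the product of the nonzero generic messages of the
rounds `< T` and of `f(x) - f(y)` (after identification). -/
def Phi (E : Finset (Cell n)) : R n :=
  (∏ t ∈ (Finset.range T).filter (fun t => P.gen E t ≠ 0), P.gen E t) * subst E (polyX f - polyY f)

/-- For `F ⊇ E`, the polynomial `Phi E` vanishes identically after identifying `F` and the generic
output cell of `E` (correctness at the generic points of that subspace, then `MvPolynomial.funext`). -/
theorem subst_insert_Phi_eq_zero {E F : Finset (Cell n)} (hEF : E ⊆ F) :
    subst (insert (P.genOut E) F) (P.Phi E) = 0 := by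
  have he : P.genOut E ∈ insert (P.genOut E) F := Finset.mem_insert_self _ F
  have hEF' : E ⊆ insert (P.genOut E) F := hEF.trans (Finset.subset_insert _ F)
  apply MvPolynomial.funext
  intro p
  rw [map_zero, ← eval_identify]
  by_contra hne
  set p' := identify (insert (P.genOut E) F) p with hp'
  rw [Phi, map_mul, map_prod] at hne
  have hgen := Finset.prod_ne_zero_iff.mp (mul_ne_zero_iff.mp hne).1
  have hper := (mul_ne_zero_iff.mp hne).2
  have hpE : ∀ c ∈ E, p' (Sum.inr c) = p' (Sum.inl c) := fun c hc => identify_agree _ p (hEF' hc)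
  have key := P.generic_output_ne E p' hpE
    (fun t ht h0 => hgen t (Finset.mem_filter.mpr ⟨Finset.mem_range.mpr ht, h0⟩)) ?_
  · exact key (identify_agree _ p he).symm
  · rw [eval_subst_of_agree E p' hpE, map_sub, eval_polyX, eval_polyY, sub_ne_zero] at hper
    exact hper

/-- **Zariski step.**  If two cells are to spare, the generic output cell `e` of `E` is a new cell,
and identifying it (`y_e ↦ x_e` on top of `E`) kills a nonzero generic message of a round `< T`. -/
theorem zariski_step (E : Finset (Cell n)) {e₀ : Cell n} (he₀ : e₀ ∉ E)
    (hroom : ∀ e, ∃ e₁, e₁ ∉ insert e E) :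
    ∃ t < T, P.genOut E ∉ E ∧ P.gen E t ≠ 0 ∧ subst (insert (P.genOut E) E) (P.gen E t) = 0 := by
  have hnot : P.genOut E ∉ E := by
    intro he
    have hzero := P.subst_insert_Phi_eq_zero (subset_rfl (a := E))
    rw [Finset.insert_eq_of_mem he, Phi, map_mul, map_prod, subst_idem, mul_eq_zero,
      Finset.prod_eq_zero_iff] at hzero
    rcases hzero with ⟨t, ht, h0⟩ | h0
    · rw [P.subst_gen_of_subset subset_rfl] at h0
      exact (Finset.mem_filter.mp ht).2 h0
    · exact subst_polyX_sub_polyY_ne_zero P.dep E he₀ h0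
  obtain ⟨e₁, he₁⟩ := hroom (P.genOut E)
  set F := insert (P.genOut E) E with hF
  have hzero := P.subst_insert_Phi_eq_zero (subset_rfl (a := E))
  rw [Phi, map_mul, map_prod, subst_subst_of_subset (Finset.subset_insert _ E), mul_eq_zero,
    Finset.prod_eq_zero_iff] at hzero
  rcases hzero with ⟨t, ht, h0⟩ | h0
  · obtain ⟨htT, hne⟩ := Finset.mem_filter.mp ht
    exact ⟨t, Finset.mem_range.mp htT, hnot, hne, h0⟩
  · exact (subst_polyX_sub_polyY_ne_zero P.dep F he₁ h0).elim

/-! ## The specialisation lemma -/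

/-- **Specialisation.**  If no nonzero generic message on `E` of a round `< t` is killed by `subst F`
(`E ⊆ F`), then the generic zero patterns on `E` and on `F` agree below `t`, the generic speakers agree
up to and including round `t`, and the generic messages on `F` of the rounds `≤ t` are the
`subst F`-images of those on `E`. -/
theorem spec_of_not_killed {E F : Finset (Cell n)} (hEF : E ⊆ F) :
    ∀ t, (∀ j < t, ¬ (P.gen E j ≠ 0 ∧ subst F (P.gen E j) = 0)) →
      (∀ j < t, P.genPat F j = P.genPat E j) ∧ P.gOwner F t = P.gOwner E t ∧
        P.gen F t = subst F (P.gen E t) := by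
  intro t
  induction t using Nat.strong_induction_on with
  | _ t ih =>
    intro hnk
    have hprev : ∀ j : Fin t, P.gen F j = subst F (P.gen E j) := fun j =>
      (ih j j.2 (fun j' hj' => hnk j' (lt_trans hj' j.2))).2.2
    have hpat : ∀ j : Fin t, P.genPat F j = P.genPat E j := by
      intro j
      have hj := hnk j j.2
      simp only [not_and] at hj
      simp only [genPat, hprev j]
      by_cases h0 : P.gen E j = 0
      · simp [h0]
      · simp [h0, hj h0]
    have h1 : (fun j : Fin t => P.genPat F j) = fun j : Fin t => P.genPat E j := funext hpat
    have hown : P.gOwner F t = P.gOwner E t := by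
      unfold gOwner; rw [h1]
    have h2 : (fun j : Fin t => subst F (P.gen F j)) = fun j : Fin t => subst F (P.gen E j) := by
      funext j
      rw [hprev j, subst_idem]
    refine ⟨fun j hj => hpat ⟨j, hj⟩, hown, ?_⟩
    conv_lhs => rw [← P.subst_gen_of_subset (subset_rfl (a := F)) t]
    rw [P.subst_gen_eq_aeval subset_rfl t, P.subst_gen_eq_aeval hEF t, h1, h2, hown]

/-- Specialisation, message form. -/
theorem gen_eq_subst_gen_of_not_killed {E F : Finset (Cell n)} (hEF : E ⊆ F)
    (t : ℕ) (hnk : ∀ j < t, ¬ (P.gen E j ≠ 0 ∧ subst F (P.gen E j) = 0)) :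
    P.gen F t = subst F (P.gen E t) :=
  (P.spec_of_not_killed hEF t hnk).2.2

/-- Specialisation, zero-pattern form. -/
theorem genPat_eq_of_not_killed {E F : Finset (Cell n)} (hEF : E ⊆ F)
    (t : ℕ) (hnk : ∀ j < t, ¬ (P.gen E j ≠ 0 ∧ subst F (P.gen E j) = 0)) :
    ∀ j < t, P.genPat F j = P.genPat E j :=
  (P.spec_of_not_killed hEF t hnk).1

/-- Specialisation, speaker form (up to and including round `t`). -/
theorem gOwner_eq_of_not_killed {E F : Finset (Cell n)} (hEF : E ⊆ F)
    (t : ℕ) (hnk : ∀ j < t, ¬ (P.gen E j ≠ 0 ∧ subst F (P.gen E j) = 0)) :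
    ∀ j ≤ t, P.gOwner F j = P.gOwner E j := fun j hj =>
  (P.spec_of_not_killed hEF j (fun j' hj' => hnk j' (lt_of_lt_of_le hj' hj))).2.1

end HProtocol

end

end Summit.ValiantsHypothesis.ValiantsHypothesis.Theorems.AlgebraicKWGames.OneAlt
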